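import Mathlib
import Summits.KontsevichZagierPeriods.Zeta5Search.DenomLaw.ZeroCoverKit
import Summits.KontsevichZagierPeriods.Zeta5Search.ZeroPointWindows
import HarnessLib

/-!
# ζ(5) search — a COVER KIT for the ZERO-POINT type-space law (`ResidueLaw.typeSpaceLawZeroPoint_holds`, `casLB + 4`): the two universal `M = 8` one-point windows, any `b`, any `j` — DENOM-LAW prover-d1 gen 18

HONEST FRAMING: systematic search; no irrationality claim unless certified.  Cell `pub-zeta5`, track «DENOM-LAW», seat `denom-prover-d1`
gen 18 (`HOME/denom-law/prover-d1/ATTEMPT-18.md` §2).  `p`-adic valuation bookkeeping for the explicit rationals `Cas_j(b)` (the contiguity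
Casoratian of the Brown–Zudilin dual coefficients); nothing about ζ(5); no model exponent moves; records in print UNMOVED.

One-point twin of `DenomLaw/ZeroCoverKit` (gen 17).  The ONE-POINT zero-regime type-space law (gen-2 g11 §4, `𝒲 = 0`; PROVED, p3 gen 2:
`typeSpaceLawZeroPoint_holds`, `v_p(Cas_j(b)) ≥ 7 − 2M`) is consumed through p3 gen 4's reduction `ZeroWindows.pointBound_of_classes`:
`ZeroWindowClasses b p M D S` with `D` palindromic and `|D| + |S| ≤ 1` (a single deep palindrome and no extra pair, or no deep class and one extra
conjugate pair — then every two live orbit points are EQUAL) and DEG ⇒ `7 − 2M`.  This file is the any-`j` wrapper with the degree condition in the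
form `p(M − 2) ≤ 2d(b) + 1` (`zeroPointBound_of_classes`, via `ResidueLaw.sum_classExp_range`) and its two universal `M = 8` instances (value `−9`):
`zeroPoint_ZP8D` (deep palindrome `ZeroWindows.D8 = [[1,−5,−5,1]]` alone: its single raises and its odd-centre copy are the only live classes) and
`zeroPoint_ZP8S` (no class of exponent `−8`; the live layer `−7` is the one conjugate pair `T1Rays.Sz8 = [[1,−6,−3,1]]` / its reversal).  The class
structure comes from a class-type cover through gen 17's spelled-out check `DenomLaw.zeroClasses_of_cover`.  MOTIVATION (ATTEMPT-18 §1–§2, the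
global profile census): on BOTH `N_p = 18` profiles of the first period for a general sorted `b` the cell `3p ≤ d` (node value `−9` of
`DenomLaw.PathAccountingFirstPeriod`) is exactly such a one-point window — branch `(1,4)`: `D8` alone; branch `(2,3)`: `Sz8` alone (the 32 + 146
instances at `p ≤ 11` left open by gen 17).  Valuations of explicit rationals; every model exponent these feed is `< 1`.
-/

open Finset

namespace Summit.KontsevichZagierPeriods.Zeta5Search.DenomLaw

open Summit.KontsevichZagierPeriods.Zeta5Search.ClusterValuation
open Summit.KontsevichZagierPeriods.Zeta5Search.CasoratianValuation (InPolytope shift casoratian)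
open Summit.KontsevichZagierPeriods.Zeta5Search.WedgeDictionary (dOf)
open Summit.KontsevichZagierPeriods.Zeta5Search.ClassTypeCover
open Summit.KontsevichZagierPeriods.Zeta5Search.ZeroWindows (ZeroWindowClasses pointBound_of_classes)
open Summit.KontsevichZagierPeriods.Zeta5Search.ResidueLaw (sum_classExp_range)

variable {p : ℕ}

/-- **ZERO-POINT TYPE-SPACE BOUND from the class structure, any direction `j`** (`ZeroWindows.pointBound_of_classes` with the degree condition in the
form `p(M − 2) ≤ 2d(b) + 1`): on the polytope with `5 ≤ p ≤ b₀ < p² − 2`, `M ≥ 6` even, `D` palindromic with `|D| + |S| ≤ 1` and the class structure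
`ZeroWindowClasses b p M D S`: `7 − 2M ≤ v_p(Cas_j(b))`. -/
theorem zeroPointBound_of_classes {b : ℕ → ℤ} {j : ℕ} (hb : InPolytope b) (hb' : InPolytope (shift b j)) (hj1 : 1 ≤ j) (hj7 : j ≤ 7)
    (hpr : p.Prime) (hp5 : 5 ≤ p) (hpb : (p : ℤ) ≤ b 0) (hwin : (b 0 + 2 : ℤ) < (p : ℤ) ^ 2)
    {M : ℕ} (hM : 6 ≤ M) (hMe : Even M) {D S : List (List ℤ)} (hD : ∀ T ∈ D, T.reverse = T) (hlen : D.length + S.length ≤ 1)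
    (hC : ZeroWindowClasses b p M D S) (hdeg : (p : ℤ) * ((M : ℤ) - 2) ≤ 2 * dOf b + 1)
    (hcas : casoratian b j ≠ 0) : (7 : ℤ) - 2 * M ≤ padicValRat p (casoratian b j) := by
  haveI : Fact p.Prime := ⟨hpr⟩
  have hdeg' : (p : ℤ) * ((M : ℤ) - 2) + ∑ x ∈ range p, classExp b p x ≤ -4 := by
    rw [sum_classExp_range b hb hp5]; omega
  exact pointBound_of_classes b j M D S hb hb' hj1 hj7 hp5 hpb hwin hM hMe hdeg' hD hlen hC hcas

/-- **The universal `M = 8` ONE-POINT instance, deep palindrome alone** (`ZeroWindows.D8 = [[1,−5,−5,1]]`, no extra pair): the class structure at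
`(8; D8, [])` and `6p ≤ 2d(b) + 1` give `−9 ≤ v_p(Cas_j(b))` for every admissible `j`. -/
theorem zeroPoint_ZP8D {b : ℕ → ℤ} {j : ℕ} (hb : InPolytope b) (hb' : InPolytope (shift b j)) (hj1 : 1 ≤ j) (hj7 : j ≤ 7)
    (hpr : p.Prime) (hp5 : 5 ≤ p) (hpb : (p : ℤ) ≤ b 0) (hwin : (b 0 + 2 : ℤ) < (p : ℤ) ^ 2)
    (hC : ZeroWindowClasses b p 8 ZeroWindows.D8 [])
    (hdeg : (p : ℤ) * 6 ≤ 2 * dOf b + 1) (hcas : casoratian b j ≠ 0) : (-9 : ℤ) ≤ padicValRat p (casoratian b j) := by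
  have h := zeroPointBound_of_classes hb hb' hj1 hj7 hpr hp5 hpb hwin (M := 8) (by norm_num) (by decide) T1Rays.d8_pal
    (S := []) (by decide) hC (by simpa using hdeg) hcas
  simpa using h

/-- **The universal `M = 8` ONE-POINT instance, one extra pair alone** (no class of exponent `−8`; live layer `−7` = the conjugate pair
`T1Rays.Sz8 = [[1,−6,−3,1]]` / `[1,−3,−6,1]`): the class structure at `(8; [], Sz8)` and `6p ≤ 2d(b) + 1` give `−9 ≤ v_p(Cas_j(b))`. -/
theorem zeroPoint_ZP8S {b : ℕ → ℤ} {j : ℕ} (hb : InPolytope b) (hb' : InPolytope (shift b j)) (hj1 : 1 ≤ j) (hj7 : j ≤ 7)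
    (hpr : p.Prime) (hp5 : 5 ≤ p) (hpb : (p : ℤ) ≤ b 0) (hwin : (b 0 + 2 : ℤ) < (p : ℤ) ^ 2)
    (hC : ZeroWindowClasses b p 8 [] T1Rays.Sz8)
    (hdeg : (p : ℤ) * 6 ≤ 2 * dOf b + 1) (hcas : casoratian b j ≠ 0) : (-9 : ℤ) ≤ padicValRat p (casoratian b j) := by
  have h := zeroPointBound_of_classes hb hb' hj1 hj7 hpr hp5 hpb hwin (M := 8) (by norm_num) (by decide) (D := []) (by simp)
    (S := T1Rays.Sz8) (by decide) hC (by simpa using hdeg) hcas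
  simpa using h

/-- Sanity of gen 17's spelled-out zero check on the two one-point inventories: the `3p ≤ d` live types of the `N_p = 18` branch `(1,4)` (deep
`[1,−5,−5,1]`, its two single raises, its odd-centre copy; `S = []`) … -/
example : ([([1, -5, -5, 1], false), ([1, -5, -4, 1], false), ([1, -4, -5, 1], false), ([1, -5, -5, 1], true), ([1, -6, 1], false),
      ([1, 1], false)] : List (List ℤ × Bool)).all (fun tc =>
      decide (polesL tc.1 = 0) ||
      ((decide (-((8 : ℕ) : ℤ) ≤ expL true tc.1 tc.2) &&
        (!decide (expL true tc.1 tc.2 = -((8 : ℕ) : ℤ)) || (!tc.2 && decide (tc.1 ∈ ZeroWindows.D8)))) &&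
        (!decide (expL true tc.1 tc.2 = -((8 : ℕ) : ℤ) + 1) ||
          (ZeroWindows.D8.any (fun T => SecondOrder.isRaise T tc.1 || (true && tc.2 && decide (tc.1 = T))) ||
            (!tc.2 && (decide (tc.1 ∈ ([] : List (List ℤ))) || decide (tc.1.reverse ∈ ([] : List (List ℤ))))))))) = true := by decide

/-- … and of the branch `(2,3)` (no class of exponent `−8`; the conjugate pair `[1,−6,−3,1]` / `[1,−3,−6,1]` through `Sz8` and its reversal). -/
example : ([([1, -6, -3, 1], false), ([1, -3, -6, 1], false), ([1, -4, -4, 1], true), ([1, -6, 1], false), ([1, 1], false)] :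
      List (List ℤ × Bool)).all (fun tc =>
      decide (polesL tc.1 = 0) ||
      ((decide (-((8 : ℕ) : ℤ) ≤ expL true tc.1 tc.2) &&
        (!decide (expL true tc.1 tc.2 = -((8 : ℕ) : ℤ)) || (!tc.2 && decide (tc.1 ∈ ([] : List (List ℤ)))))) &&
        (!decide (expL true tc.1 tc.2 = -((8 : ℕ) : ℤ) + 1) ||
          (([] : List (List ℤ)).any (fun T => SecondOrder.isRaise T tc.1 || (true && tc.2 && decide (tc.1 = T))) ||
            (!tc.2 && (decide (tc.1 ∈ T1Rays.Sz8) || decide (tc.1.reverse ∈ T1Rays.Sz8))))))) = true := by decide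

end Summit.KontsevichZagierPeriods.Zeta5Search.DenomLaw
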